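import Mathlib
import HarnessLib
import Summits.Ventures.LatticeQCDFlow.Exactness.NCMCGeneralSpaceErgodicRun
import Summits.Ventures.LatticeQCDFlow.Scoring.VarianceOfTheMean

/-!
# Correlated starts, stationarity alone: unbiased exponential averages, the bias sign of `ΔF̂_n`, and the exact variance `2 τ_n σ² / n`

HONEST FRAMING: exact (Metropolis-corrected) sampling algorithms for lattice gauge theory;
figures of merit are autocorrelation/cost numbers at stated couplings and volumes; no
continuum-physics claim.

Venture `LatticeQCDFlow` (cell pub-lqcd), topic `Exactness`; FANOUT row 13 (`eng-snf`, GEN-16).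
NEW WORK of the cell, not a published result; no definition is introduced; nothing is cited as a
fact (the `2 τ_int` inflation of the variance of a mean of correlated samples — Madras–Sokal 1988,
Sokal's 1996 Cargèse lectures §2 — is named only; the finite-`n` pair count used here is row 11's
theorem `Scoring.variance_sum_range_of_cov_eq` with its Fejér-weighted `Scoring.tauIntN`).
Companion of `NCMCGeneralSpaceErgodicRun.lean` (strong laws need ergodicity); THIS file records what
STATIONARITY ALONE of the stream of evolution records gives — the engine's actual sampling scheme
(start configurations read every `n_between` sweeps off one equilibrium chain) produces a stationary
stream as soon as the level sampler is started in, or has relaxed to, equilibrium.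

## Setting

Records `E`; streams `ω : ℕ → E`; shift `fun ω k ↦ ω (k + 1)`; `P` a probability law on streams,
STATIONARY: `MeasurePreserving (shift) P P`; one-record marginal `P.map (fun ω ↦ ω 0) = μ`; a
one-record observable `φ : E → ℝ` (think `e^{−W}`); lag autocovariances
`γ_t := cov[φ(ω 0), φ(ω t); P]`.

## Content

* `eval_eq_eval_zero_comp_shift_iterate`, `map_shift_iterate_of_stationary`,
  **`map_eval_of_stationary`** (every one-record marginal is `μ`), `integral_comp_eval_of_stationary`,
  `integrable_comp_eval_of_stationary`, `memLp_comp_eval_of_stationary`.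
* **`integral_sum_div_of_stationary`** / `integral_sampleMean_of_stationary` — the running mean of
  `φ` is UNBIASED for `E_μ φ` at every `n ≥ 1`, correlations notwithstanding;
  **`CrooksPair.integral_sampleMean_exp_neg_work_of_stationary`** — JARZYNSKI'S IDENTITY FOR
  CORRELATED EQUILIBRIUM STARTS: `E_P[(1/n) Σ_{i<n} e^{−W_i}] = Z₁/Z₀ = e^{−ΔF}` exactly — what the
  identity needs is equilibrium starts, not independent ones.
* **`neg_log_integral_le_integral_jarzynskiEstimate_of_stationary`** /
  **`CrooksPair.freeEnergyDiff_le_integral_jarzynskiEstimate_of_stationary`** — Jensen: the bias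
  SIGN of GEN-11 survives correlation, `ΔF ≤ E_P[ΔF̂_n]` for every `n ≥ 1` (its monotonicity in `n`,
  `NCMCGeneralSpaceEstimatorBias.integral_jarzynskiEstimate_antitone`, is an independence statement
  and is NOT claimed here).
* **`covariance_comp_eval_of_stationary`**, `covariance_comp_eval_eq_dist` — covariances along a
  stationary stream depend on the lag only; **`variance_sum_of_stationary`** —
  `Var_P[Σ_{i<n} φ(ω i)] = n γ₀ + 2 Σ_{t<n} (n − t − 1) γ_{t+1}`; **`variance_sum_div_of_stationary`**
  (the mean: divided by `n²`); **`variance_sum_div_eq_tauIntN_of_stationary`** — with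
  `σ² = Var_μ φ ≠ 0` and `ρ_t = γ_t/σ²`: `Var_P[(1/n) Σ_{i<n} φ(ω i)] = 2 τ_n(ρ) σ² / n` EXACTLY, where
  `τ_n = ½ + Σ_{t=1}^{n} (1 − t/n) ρ_t` is row 11's `Scoring.tauIntN`;
  **`CrooksPair.variance_sampleMean_exp_neg_work_of_stationary`** — for the exponential average of a
  Crooks pair along a stationary stream with marginal `P_F` and `e^{−W} ∈ L²(P_F)`: relative variance
  `= 2 τ_n(ρ_w) (1/ESS_F − 1) / n`, `ρ_w` the autocorrelation of the WEIGHT stream `e^{−W_i}` — the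
  honest effective number of independent evolutions behind a correlated-start `ess` column is
  `n / (2 τ_n(ρ_w))`, with `τ` that of the weights, not of the plaquette.

NOT CLAIMED: any value of `τ_n` for a concrete sampler; positivity or summability of `γ_t`; the
Γ-method estimator of `τ`; anything needing ergodicity (see the companion file) or mixing rates
(row 8's Doeblin files bound `τ` for bounded observables under a minorisation).
-/

namespace Summit.Ventures.LatticeQCDFlow.Exactness.GeneralNCMC

open MeasureTheory ProbabilityTheory Set Filter Finset
open scoped ENNReal Topology

variable {E : Type*} [MeasurableSpace E]

/-! ## Marginals and means along a stationary stream -/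

section Stationary

variable {P : Measure (ℕ → E)} {μ : Measure E}

omit [MeasurableSpace E] in
/-- Reading coordinate `i` is reading coordinate `0` after `i` shifts. -/
theorem eval_eq_eval_zero_comp_shift_iterate (i : ℕ) :
    (fun ω : ℕ → E => ω i) = (fun ω : ℕ → E => ω 0) ∘ (fun (ω : ℕ → E) (k : ℕ) => ω (k + 1))^[i] := by
  funext ω
  rw [Function.comp_apply, shift_iterate_apply, Nat.zero_add]

/-- A stationary stream law is invariant under every iterate of the shift. -/
theorem map_shift_iterate_of_stationary
    (hS : MeasurePreserving (fun (ω : ℕ → E) (k : ℕ) => ω (k + 1)) P P) (i : ℕ) :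
    P.map ((fun (ω : ℕ → E) (k : ℕ) => ω (k + 1))^[i]) = P :=
  (hS.iterate i).map_eq

/-- **Every one-record marginal of a stationary stream is `μ`.** -/
theorem map_eval_of_stationary (hS : MeasurePreserving (fun (ω : ℕ → E) (k : ℕ) => ω (k + 1)) P P)
    (hμ : P.map (fun ω => ω 0) = μ) (i : ℕ) : P.map (fun ω => ω i) = μ := by
  rw [eval_eq_eval_zero_comp_shift_iterate i, ← Measure.map_map (measurable_pi_apply 0)
    (measurable_shift.iterate i), map_shift_iterate_of_stationary hS, hμ]

/-- Reading coordinate `i` of a stationary stream is measure preserving onto `μ`. -/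
theorem measurePreserving_eval_of_stationary
    (hS : MeasurePreserving (fun (ω : ℕ → E) (k : ℕ) => ω (k + 1)) P P)
    (hμ : P.map (fun ω => ω 0) = μ) (i : ℕ) : MeasurePreserving (fun ω : ℕ → E => ω i) P μ :=
  ⟨measurable_pi_apply i, map_eval_of_stationary hS hμ i⟩

/-- A one-record observable read at any index integrates to its `μ`-mean. -/
theorem integral_comp_eval_of_stationary
    (hS : MeasurePreserving (fun (ω : ℕ → E) (k : ℕ) => ω (k + 1)) P P)
    (hμ : P.map (fun ω => ω 0) = μ) {φ : E → ℝ} (hφ : AEStronglyMeasurable φ μ) (i : ℕ) :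
    ∫ ω, φ (ω i) ∂P = ∫ a, φ a ∂μ := by
  rw [← integral_map (measurable_pi_apply i).aemeasurable (by rw [map_eval_of_stationary hS hμ i]; exact hφ),
    map_eval_of_stationary hS hμ i]

/-- A `μ`-integrable one-record observable read at any index is `P`-integrable. -/
theorem integrable_comp_eval_of_stationary
    (hS : MeasurePreserving (fun (ω : ℕ → E) (k : ℕ) => ω (k + 1)) P P)
    (hμ : P.map (fun ω => ω 0) = μ) {φ : E → ℝ} (hφ : Integrable φ μ) (i : ℕ) :
    Integrable (fun ω : ℕ → E => φ (ω i)) P :=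
  (measurePreserving_eval_of_stationary hS hμ i).integrable_comp_of_integrable hφ

/-- A one-record observable in `L²(μ)` read at any index is in `L²(P)`. -/
theorem memLp_comp_eval_of_stationary
    (hS : MeasurePreserving (fun (ω : ℕ → E) (k : ℕ) => ω (k + 1)) P P)
    (hμ : P.map (fun ω => ω 0) = μ) {φ : E → ℝ} (hφ : MemLp φ 2 μ) (i : ℕ) :
    MemLp (fun ω : ℕ → E => φ (ω i)) 2 P := by
  have h := map_eval_of_stationary hS hμ i
  rw [← h] at hφ
  exact hφ.comp_of_map (measurable_pi_apply i).aemeasurable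

/-- **The running mean is unbiased at every `n ≥ 1`, correlations notwithstanding**:
`E_P[(1/n) Σ_{i<n} φ(ω i)] = E_μ φ`. -/
theorem integral_sum_div_of_stationary
    (hS : MeasurePreserving (fun (ω : ℕ → E) (k : ℕ) => ω (k + 1)) P P)
    (hμ : P.map (fun ω => ω 0) = μ) {φ : E → ℝ} (hφ : Integrable φ μ) {n : ℕ} (hn : n ≠ 0) :
    ∫ ω, (∑ i ∈ range n, φ (ω i)) / n ∂P = ∫ a, φ a ∂μ := by
  have hn' : (n : ℝ) ≠ 0 := by exact_mod_cast hn
  have hsum : ∫ ω, ∑ i ∈ range n, φ (ω i) ∂P = ∑ i ∈ range n, ∫ ω, φ (ω i) ∂P :=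
    integral_finsetSum _ fun i _ => integrable_comp_eval_of_stationary hS hμ hφ i
  simp_rw [div_eq_mul_inv]
  rw [integral_mul_const, hsum, sum_congr rfl fun i _ =>
    integral_comp_eval_of_stationary hS hμ hφ.aestronglyMeasurable i, sum_const, card_range,
    nsmul_eq_mul]
  field_simp

/-- The same in the vocabulary of `JarzynskiEstimatorBias.sampleMean`. -/
theorem integral_sampleMean_of_stationary
    (hS : MeasurePreserving (fun (ω : ℕ → E) (k : ℕ) => ω (k + 1)) P P)
    (hμ : P.map (fun ω => ω 0) = μ) {φ : E → ℝ} (hφ : Integrable φ μ) {n : ℕ} (hn : n ≠ 0) :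
    ∫ ω, sampleMean φ (fun i : Fin n => ω i) ∂P = ∫ a, φ a ∂μ := by
  rw [← integral_sum_div_of_stationary hS hμ hφ hn]
  refine integral_congr_ae (Eventually.of_forall fun ω => ?_)
  dsimp only [sampleMean]
  rw [Fin.sum_univ_eq_sum_range (fun i => φ (ω i)) n]

/-- **Jensen: the bias sign of the Jarzynski estimate survives correlation.**  Along a stationary
stream with marginal `μ`, a positive weight `w ∈ L¹(μ)` and `n ≥ 1`:
`−log E_μ w ≤ E_P[ΔF̂_n]` (with `ΔF̂_n = −log ((1/n) Σ_{i<n} w(ω i))`, assumed integrable). -/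
theorem neg_log_integral_le_integral_jarzynskiEstimate_of_stationary [IsProbabilityMeasure P]
    (hS : MeasurePreserving (fun (ω : ℕ → E) (k : ℕ) => ω (k + 1)) P P)
    (hμ : P.map (fun ω => ω 0) = μ) {w : E → ℝ} (hwpos : ∀ a, 0 < w a) (hw : Integrable w μ)
    {n : ℕ} (hn : 0 < n)
    (hlog : Integrable (fun ω : ℕ → E => Real.log (sampleMean w (fun i : Fin n => ω i))) P) :
    -Real.log (∫ a, w a ∂μ) ≤ ∫ ω, jarzynskiEstimate w (fun i : Fin n => ω i) ∂P := by
  have hsm : Integrable (fun ω : ℕ → E => sampleMean w (fun i : Fin n => ω i)) P := by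
    have : Integrable (fun ω : ℕ → E => (∑ i ∈ range n, w (ω i)) / n) P :=
      (integrable_finsetSum _ fun i _ => integrable_comp_eval_of_stationary hS hμ hw i).div_const _
    refine this.congr (Eventually.of_forall fun ω => ?_)
    dsimp only [sampleMean]
    rw [Fin.sum_univ_eq_sum_range (fun i => w (ω i)) n]
  have hexp : (Real.exp ∘ fun ω : ℕ → E => Real.log (sampleMean w (fun i : Fin n => ω i))) =
      fun ω => sampleMean w (fun i : Fin n => ω i) := by
    funext ω
    simp only [Function.comp_apply]
    exact Real.exp_log (sampleMean_pos hwpos hn _)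
  have hgi : Integrable (Real.exp ∘ fun ω : ℕ → E => Real.log (sampleMean w (fun i : Fin n => ω i))) P := by
    rw [hexp]
    exact hsm
  have hj := convexOn_exp.map_integral_le Real.continuous_exp.continuousOn isClosed_univ
    (Eventually.of_forall fun x => mem_univ _) hlog hgi
  have hrhs : ∫ ω, Real.exp (Real.log (sampleMean w (fun i : Fin n => ω i))) ∂P =
      ∫ ω, sampleMean w (fun i : Fin n => ω i) ∂P :=
    integral_congr_ae (Eventually.of_forall fun ω => Real.exp_log (sampleMean_pos hwpos hn _))
  rw [hrhs, integral_sampleMean_of_stationary hS hμ hw hn.ne'] at hj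
  have hpos : 0 < ∫ a, w a ∂μ := lt_of_lt_of_le (Real.exp_pos _) hj
  have hle : ∫ ω, Real.log (sampleMean w (fun i : Fin n => ω i)) ∂P ≤ Real.log (∫ a, w a ∂μ) :=
    (Real.le_log_iff_exp_le hpos).2 hj
  unfold jarzynskiEstimate
  rw [integral_neg]
  linarith

end Stationary

/-! ## Covariances depend on the lag only; the exact variance of the running mean -/

section Covariance

variable {P : Measure (ℕ → E)} {μ : Measure E}

/-- **Covariances along a stationary stream depend on the lag only**:
`cov[φ(ω i), φ(ω (t + i))] = cov[φ(ω 0), φ(ω t)] =: γ_t`. -/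
theorem covariance_comp_eval_of_stationary
    (hS : MeasurePreserving (fun (ω : ℕ → E) (k : ℕ) => ω (k + 1)) P P)
    (hμ : P.map (fun ω => ω 0) = μ) {φ : E → ℝ} (hφ : AEStronglyMeasurable φ μ) (i t : ℕ) :
    cov[fun ω : ℕ → E => φ (ω i), fun ω : ℕ → E => φ (ω (t + i)); P] =
      cov[fun ω : ℕ → E => φ (ω 0), fun ω : ℕ → E => φ (ω t); P] := by
  have hmap := map_shift_iterate_of_stationary hS i
  have h0 : AEStronglyMeasurable (fun ω : ℕ → E => φ (ω 0))
      (P.map ((fun (ω : ℕ → E) (k : ℕ) => ω (k + 1))^[i])) := by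
    rw [hmap]
    exact hφ.comp_measurePreserving (measurePreserving_eval_of_stationary hS hμ 0)
  have ht : AEStronglyMeasurable (fun ω : ℕ → E => φ (ω t))
      (P.map ((fun (ω : ℕ → E) (k : ℕ) => ω (k + 1))^[i])) := by
    rw [hmap]
    exact hφ.comp_measurePreserving (measurePreserving_eval_of_stationary hS hμ t)
  have key := covariance_map_fun h0 ht (measurable_shift.iterate i).aemeasurable (μ := P)
  rw [hmap] at key
  rw [key]
  simp only [shift_iterate_apply, Nat.zero_add]

/-- The lag-only form with `Nat.dist`: `cov[φ(ω i), φ(ω j)] = γ_{|i − j|}`. -/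
theorem covariance_comp_eval_eq_dist
    (hS : MeasurePreserving (fun (ω : ℕ → E) (k : ℕ) => ω (k + 1)) P P)
    (hμ : P.map (fun ω => ω 0) = μ) {φ : E → ℝ} (hφ : AEStronglyMeasurable φ μ) (i j : ℕ) :
    cov[fun ω : ℕ → E => φ (ω i), fun ω : ℕ → E => φ (ω j); P] =
      cov[fun ω : ℕ → E => φ (ω 0), fun ω : ℕ → E => φ (ω (Nat.dist i j)); P] := by
  rcases le_total i j with hij | hji
  · rw [Nat.dist_eq_sub_of_le hij, ← covariance_comp_eval_of_stationary hS hμ hφ i (j - i),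
      Nat.sub_add_cancel hij]
  · rw [Nat.dist_eq_sub_of_le_right hji, covariance_comm,
      ← covariance_comp_eval_of_stationary hS hμ hφ j (i - j), Nat.sub_add_cancel hji]

variable [IsProbabilityMeasure P]

/-- **The exact variance of a sum along a stationary stream**:
`Var_P[Σ_{i<n} φ(ω i)] = n γ₀ + 2 Σ_{t<n} (n − t − 1) γ_{t+1}`, `γ_t = cov[φ(ω 0), φ(ω t); P]`
(row 11's pair count `Scoring.variance_sum_range_of_cov_eq`). -/
theorem variance_sum_of_stationary
    (hS : MeasurePreserving (fun (ω : ℕ → E) (k : ℕ) => ω (k + 1)) P P)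
    (hμ : P.map (fun ω => ω 0) = μ) {φ : E → ℝ} (hφ : MemLp φ 2 μ) (n : ℕ) :
    Var[∑ i ∈ range n, fun ω : ℕ → E => φ (ω i); P] =
      n * cov[fun ω : ℕ → E => φ (ω 0), fun ω : ℕ → E => φ (ω 0); P] +
        2 * ∑ t ∈ range n, ((n : ℝ) - (t + 1)) *
          cov[fun ω : ℕ → E => φ (ω 0), fun ω : ℕ → E => φ (ω (t + 1)); P] :=
  Scoring.variance_sum_range_of_cov_eq (fun i (ω : ℕ → E) => φ (ω i))
    (fun t => cov[fun ω : ℕ → E => φ (ω 0), fun ω : ℕ → E => φ (ω t); P]) n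
    (fun i _ => memLp_comp_eval_of_stationary hS hμ hφ i)
    (fun i _ j _ => covariance_comp_eval_eq_dist hS hμ hφ.aestronglyMeasurable i j)

/-- **The exact variance of the running mean along a stationary stream**:
`Var_P[(1/n) Σ_{i<n} φ(ω i)] = (n γ₀ + 2 Σ_{t<n} (n − t − 1) γ_{t+1}) / n²`. -/
theorem variance_sum_div_of_stationary
    (hS : MeasurePreserving (fun (ω : ℕ → E) (k : ℕ) => ω (k + 1)) P P)
    (hμ : P.map (fun ω => ω 0) = μ) {φ : E → ℝ} (hφ : MemLp φ 2 μ) (n : ℕ) :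
    Var[fun ω : ℕ → E => (∑ i ∈ range n, φ (ω i)) / n; P] =
      (n * cov[fun ω : ℕ → E => φ (ω 0), fun ω : ℕ → E => φ (ω 0); P] +
        2 * ∑ t ∈ range n, ((n : ℝ) - (t + 1)) *
          cov[fun ω : ℕ → E => φ (ω 0), fun ω : ℕ → E => φ (ω (t + 1)); P]) / (n : ℝ) ^ 2 := by
  have h1 : (fun ω : ℕ → E => (∑ i ∈ range n, φ (ω i)) / n) =
      fun ω => (n : ℝ)⁻¹ * (∑ i ∈ range n, fun ω : ℕ → E => φ (ω i)) ω := by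
    funext ω
    rw [Finset.sum_apply, div_eq_inv_mul]
  rw [h1, variance_const_mul, variance_sum_of_stationary hS hμ hφ n, inv_pow, div_eq_inv_mul]

omit [IsProbabilityMeasure P] in
/-- The lag-`0` autocovariance is the one-record variance `Var_μ φ`. -/
theorem covariance_comp_eval_zero_self
    (hμ : P.map (fun ω => ω 0) = μ) {φ : E → ℝ} (hφ : AEStronglyMeasurable φ μ) :
    cov[fun ω : ℕ → E => φ (ω 0), fun ω : ℕ → E => φ (ω 0); P] = Var[φ; μ] := by
  have hmp : MeasurePreserving (fun ω : ℕ → E => ω 0) P μ := ⟨measurable_pi_apply 0, hμ⟩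
  rw [covariance_self (X := fun ω : ℕ → E => φ (ω 0)) (hφ.comp_measurePreserving hmp).aemeasurable,
    hmp.variance_fun_comp hφ.aemeasurable]

/-- **`Var_P[(1/n) Σ_{i<n} φ(ω i)] = 2 τ_n(ρ) σ² / n` exactly**, with `σ² = Var_μ φ ≠ 0`, the
normalised autocorrelation `ρ_t = γ_t / σ²` of the stream and row 11's Fejér-weighted
`τ_n(ρ) = ½ + Σ_{t=1}^{n} (1 − t/n) ρ_t` (`Scoring.tauIntN`). -/
theorem variance_sum_div_eq_tauIntN_of_stationary
    (hS : MeasurePreserving (fun (ω : ℕ → E) (k : ℕ) => ω (k + 1)) P P)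
    (hμ : P.map (fun ω => ω 0) = μ) {φ : E → ℝ} (hφ : MemLp φ 2 μ) (hσ : Var[φ; μ] ≠ 0)
    {n : ℕ} (hn : n ≠ 0) :
    Var[fun ω : ℕ → E => (∑ i ∈ range n, φ (ω i)) / n; P] =
      2 * Scoring.tauIntN (fun t => cov[fun ω : ℕ → E => φ (ω 0), fun ω : ℕ → E => φ (ω t); P] /
        Var[φ; μ]) n * Var[φ; μ] / n := by
  refine Scoring.variance_mean_range_of_cov_eq (fun i (ω : ℕ → E) => φ (ω i)) (Var[φ; μ])
    (fun t => cov[fun ω : ℕ → E => φ (ω 0), fun ω : ℕ → E => φ (ω t); P] / Var[φ; μ]) ?_ hn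
    (fun i _ => memLp_comp_eval_of_stationary hS hμ hφ i) (fun i _ j _ => ?_)
  · try dsimp only
    rw [covariance_comp_eval_zero_self hμ hφ.aestronglyMeasurable, div_self hσ]
  · try dsimp only
    rw [covariance_comp_eval_eq_dist hS hμ hφ.aestronglyMeasurable i j, mul_div_cancel₀ _ hσ]

end Covariance

/-! ## Crooks pairs: Jarzynski's identity and the honest `ess` for correlated equilibrium starts -/

namespace CrooksPair

variable {Ω : Type*} [MeasurableSpace Ω]
variable {ν₀ ν₁ : Measure Ω} {κF κR : Kernel Ω E} {s e : E → Ω} {W : E → ℝ}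
variable {P : Measure (ℕ → E)}

/-- **JARZYNSKI'S IDENTITY FOR CORRELATED EQUILIBRIUM STARTS.**  For every Crooks pair on a general
measurable state space and every STATIONARY stream of its forward evolutions whose one-record
marginal is the equilibrium path law `P_F`: `E_P[(1/n) Σ_{i<n} e^{−W_i}] = Z₁/Z₀` (`= e^{−ΔF}`) for
every `n ≥ 1`.  Independence of the evolutions is not needed; equilibrium of the starts is. -/
theorem integral_sampleMean_exp_neg_work_of_stationary [IsFiniteMeasure ν₁] [IsMarkovKernel κR]
    (h0 : ν₀ univ ≠ 0) (h : CrooksPair ν₀ ν₁ κF κR s e W)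
    (hS : MeasurePreserving (fun (ω : ℕ → E) (k : ℕ) => ω (k + 1)) P P)
    (hμ : P.map (fun ω => ω 0) = fwdPathLaw ν₀ κF) {n : ℕ} (hn : n ≠ 0) :
    ∫ ω, sampleMean (fun ε => Real.exp (-W ε)) (fun i : Fin n => ω i) ∂P =
      ((ν₀ univ)⁻¹ * ν₁ univ).toReal := by
  rw [integral_sampleMean_of_stationary hS hμ (h.integrable_exp_neg_work h0) hn,
    h.integral_exp_neg_work]

/-- **`ΔF ≤ E_P[ΔF̂_n]` along a stationary stream** (`n ≥ 1`, `ΔF̂_n` integrable): the finite-sample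
Jarzynski estimate over correlated equilibrium starts still over-estimates `ΔF` on average. -/
theorem freeEnergyDiff_le_integral_jarzynskiEstimate_of_stationary [IsFiniteMeasure ν₀]
    [IsFiniteMeasure ν₁] [IsMarkovKernel κF] [IsMarkovKernel κR] [IsProbabilityMeasure P]
    (h0 : ν₀ univ ≠ 0) (h : CrooksPair ν₀ ν₁ κF κR s e W) {ΔF : ℝ}
    (hΔF : Real.exp (-ΔF) = ((ν₀ univ)⁻¹ * ν₁ univ).toReal)
    (hS : MeasurePreserving (fun (ω : ℕ → E) (k : ℕ) => ω (k + 1)) P P)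
    (hμ : P.map (fun ω => ω 0) = fwdPathLaw ν₀ κF) {n : ℕ} (hn : 0 < n)
    (hlog : Integrable (fun ω : ℕ → E =>
      Real.log (sampleMean (fun ε => Real.exp (-W ε)) (fun i : Fin n => ω i))) P) :
    ΔF ≤ ∫ ω, jarzynskiEstimate (fun ε => Real.exp (-W ε)) (fun i : Fin n => ω i) ∂P := by
  have key := neg_log_integral_le_integral_jarzynskiEstimate_of_stationary hS hμ
    (w := fun ε => Real.exp (-W ε)) (fun ε => Real.exp_pos _) (h.integrable_exp_neg_work h0) hn hlog
  rwa [h.integral_exp_neg_work, ← hΔF, Real.log_exp, neg_neg] at key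

/-- **The honest `ess` of a correlated-start run.**  Along a stationary stream of forward
evolutions with marginal `P_F` and `e^{−W} ∈ L²(P_F)`, the exponential average
`Ȳ_n = (1/n) Σ_{i<n} e^{−W_i}` (mean `Z₁/Z₀ = e^{−ΔF}`) has RELATIVE variance
`Var_P[Ȳ_n] / (Z₁/Z₀)² = 2 τ_n(ρ_w) · (Var_F[e^{−W}] / (Z₁/Z₀)²) / n`, where
`Var_F[e^{−W}]/(Z₁/Z₀)² = 1/ESS_F − 1` (`CrooksPair.variance_exp_neg_work_div_sq`) and `ρ_w` is the
normalised autocorrelation of the WEIGHT stream `(e^{−W_i})_i`: the run is worth `n / (2 τ_n(ρ_w))`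
independent evolutions (`Var_F[e^{−W}] ≠ 0`, i.e. the protocol is not dissipation-free). -/
theorem variance_sampleMean_exp_neg_work_of_stationary [IsMarkovKernel κR] [IsProbabilityMeasure P]
    (h : CrooksPair ν₀ ν₁ κF κR s e W)
    (hL2 : MemLp (fun ε => Real.exp (-W ε)) 2 (fwdPathLaw ν₀ κF))
    (hσ : Var[fun ε => Real.exp (-W ε); fwdPathLaw ν₀ κF] ≠ 0)
    (hS : MeasurePreserving (fun (ω : ℕ → E) (k : ℕ) => ω (k + 1)) P P)
    (hμ : P.map (fun ω => ω 0) = fwdPathLaw ν₀ κF) {n : ℕ} (hn : n ≠ 0) :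
    Var[fun ω : ℕ → E => (∑ i ∈ range n, Real.exp (-W (ω i))) / n; P] /
        ((ν₀ univ)⁻¹ * ν₁ univ).toReal ^ 2 =
      2 * Scoring.tauIntN (fun t => cov[fun ω : ℕ → E => Real.exp (-W (ω 0)),
          fun ω : ℕ → E => Real.exp (-W (ω t)); P] /
          Var[fun ε => Real.exp (-W ε); fwdPathLaw ν₀ κF]) n *
        (Var[fun ε => Real.exp (-W ε); fwdPathLaw ν₀ κF] /
          (∫ ε, Real.exp (-W ε) ∂(fwdPathLaw ν₀ κF)) ^ 2) / n := by
  rw [variance_sum_div_eq_tauIntN_of_stationary hS hμ (φ := fun ε => Real.exp (-W ε)) hL2 hσ hn,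
    h.integral_exp_neg_work]
  ring

end CrooksPair

end Summit.Ventures.LatticeQCDFlow.Exactness.GeneralNCMC
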